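import Mathlib
import Literature.MathematicalPhysics.QuantumFieldTheory.Balaban1983to89.B11SectG

/-! # `Balaban1983to89.B11HolderComplex` — the Hölder entry of (190) integrated along a segment: the printed
B11-side producer of the (1,β)-Hölder bound of the ANALYTIC minimiser 𝓗(B) of Prop. 9 ([Balaban1985Variational]
Sect. G), i.e. of the shape of [Balaban1987RG1] (3.27) line 3 for complex data — the inference kernel-checked, every
analytic input displayed

CITATION HEADER (lean-in-tree rule 2026-08-18).  T. Bałaban, *The variational problem and background fields in
renormalization group method for lattice gauge theories*, Commun. Math. Phys. **102**, 277–309 (1985)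
[Balaban1985Variational] (cell paper B11; held `paper:balaban1985-cmp102-variational-background`, journal page = PDF page
+ 276): Sect. G, p. 305 [PDF 29] (opening paragraph, (172)–(175)), p. 306 [PDF 30] ((176)–(180) and the sentence after
(176)), p. 307 [PDF 31] (lines 1–2; the paragraph *"Now we consider another important problem …"*; (182)–(184)), p. 308
[PDF 32] ((185)–(190)), p. 309 [PDF 33] (Proposition 9) — renders
`b2b-balaban-ref1/pages/1985-cmp102-variational-background/1985-cmp102-variational-background-p029-x2.png`,
`…-p030-x2.png`, `…-p031-x2.png`, `…-p032-x2.png`, `…-p033-x2.png` READ AS IMAGES by the b11 seat (gen 12) 2026-08-19;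
and, for the PRINTED CONVENTION of functional-derivative kernels recorded in (R2) below (v1.1): Sect. C, pp. 287–288 [PDF
11–12] ((63)–(64)), p. 288 [PDF 12] ((66), (69)), p. 289 [PDF 13] ((71) and the sentence *"Let us notice that the factor
(Lʲη)^{−d} comes from the change of scale …"*), Sect. E, p. 298 [PDF 22] ((130)) — renders `…-p011-x2.png`,
`…-p012-x2.png`, `…-p013-x2.png`, `…-p022-x2.png` (and `…-p031-x2.png` again) READ AS IMAGES by the b11 seat (gen 13)
2026-08-19.  T. Bałaban, *Propagators for lattice gauge theories in a background field*, Commun. Math. Phys. **99**,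
389–434 (1985) [Balaban1985BackgroundPropagators] (B11's [5]; journal page = PDF page + 388): p. 397 [PDF 9], the norms
(3.39)–(3.41), the blocks Δ(y), Δ̃(y) and (3.42) — render
`…/1985-cmp99-background-propagators/1985-cmp99-background-propagators-p009-x2.png` READ AS AN IMAGE by the b11 seat (gen
12; re-read by gen 13) 2026-08-19.  CONSUMER, CONTEXT ONLY: T. Bałaban, *Renormalization group approach to lattice gauge
field theories. I*, Commun. Math. Phys. **109**, 249–301 (1987) [Balaban1987RG1] (cell paper B12; its [15] =
[Balaban1985Variational], its [14] = B11's [6]), p. 275 [PDF 27], (3.24)–(3.27) and the sentences between — render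
`…/1987-cmp109-rg-I-small-field/1987-cmp109-rg-I-small-field-p027-x2.png` READ AS AN IMAGE by the b11 seat (gen 12)
2026-08-19. T. Bałaban, *Propagators and renormalization transformations for lattice gauge theories. II*, Commun. Math.
Phys. **96**, 223–250 (1984) [Balaban1984PropagatorsII] (B11's [3]), Lemma 2.1 (2.61) p. 234 — used ONLY through the
typed row sum `B11SectG.RowSum` of the imported sibling module (whose header certifies that page).  All these papers are
UNDER ADJUDICATION by the audit cell `pub-balaban`: NOTHING printed in them is asserted here.  Every printed input enters
as a DISPLAYED HYPOTHESIS of the theorems below (the majorant `Ineq190` of `B11SectG`, the row sum `RowSum`,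
differentiability along the segment, the bump/chain geometry); what the kernel checks is the INFERENCE from them, proved
from Mathlib (Hahn–Banach `exists_extension_of_le_sublinear`, the mean-value inequality
`norm_image_sub_le_of_norm_deriv_le_segment_01'`, telescoping sums) and `B11SectG` (`HasMaj.bound`).  NEW sibling module;
imports only Mathlib and `B11SectG`; modifies nothing.  Unit `b2b-balaban-b11-g12` (planner seat, PAPER SUB-CELL B11 gen
12; journal claim G-B11-HOLDER-COMPLEX-KERNEL; v1 = p183349).  v1.1 = DOCFIX (docstring-only; every declaration
byte-identical to v1): unit `b2b-balaban-b11-g13` (gen 13; journal claim G-B11-HOLDER-COMPLEX-DOCFIX), folding the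
records-only notes of the two OUTSIDE-READER certificates of v1 — XREAD C-b09g9-3 (b09-g9; items (1) + (3): 18/18 header
quotations verbatim against the renders, the kernel-normalisation reading (a) of (R2) ATTACKED and CONFIRMED FROM PRINT,
evidence E1–E6; notes N1 evidence loci, N2 uniform wording, N3 typography) and XREAD C-lit1g9-11 (beta-lit1-g9; items
(2), (4), (5), (6) + ABSOLUTE RULE: (190) holds at every B of (172), 𝓗(0) = 0, `hdom`/`hchain` definitional, axioms
standard; notes R1 quote (184), R2 `hpath` at t = 1); cell records: GAPS G-adv5-50 (*"(3.27) third line … for the COMPLEX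
datum V … no printed statement gives a Hölder (1,β) bound for the analytic extension 𝓗 of Prop. 9"*), G-adv5-51 (the
clause is LOAD-BEARING on the complex domain of the d = 4 critical path; typed binder HölderComplexBackground handed to
the f2 / b03 lineages), C-adv5-49 (3) (the identification of B12's 𝐇_{k+1}(□₀, (1/i) log V) with Prop. 9's 𝓗(B) at V₀ =
1, and its radius clause (a) O(1)Mα₀ ≦ C₁a₁), G-B11-G2 / G-B11-G2a (the author-omitted calculation behind (189)–(190) and
the transport words of (190); KEY, already load-bearing for [Balaban1987RG1] (3.9), (3.17), (3.32), (4.5) — `B11SectG`),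
and the rows written with this file: C-B11-G12a (this certificate), DIVERGENCE D-B11-22 (modelling conventions (i)–(v)
below), C-B11-G13a (v1.1: (R2) re-graded from «interpretive, LOW» to PRINTED CONVENTION on the evidence of C-b09g9-3;
residual on the reading: none).

WHAT IS PRINTED (renders read as images).  p. 305: *"if V = V′V₀, V′ small, U₀ = U_k(V₀), and if we fix a gauge condition
for U_k(V′V₀)U₀⁻¹, then it is an analytic function of B = 1/i log V′ and it has an expansion as a power series in B."*;
(172): *"Now let us take V = V′V₀, V₀ satisfies the condition (7), V′ satisfies |V′ − 1| < C₁ε₁, hence V′ = e^{iB′}, |B′|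
< 2C₁ε₁ on 𝔅_k, (172) for ε₁ sufficiently small."*; p. 306, after (176): *"This implies that the expansion of 𝓗 begins
with the first order term H₁B."* and (177) *"𝓗 = H₁B − 𝔊((δ/δA′)V^{(3)})(H₁B) − HC^{(2)}(H₁B) + ⋯"* (so 𝓗(0) = 0); p. 306
last line – p. 307 l. 1: *"Independently of the representation chosen, the function 𝓗(B) is an analytic function of
𝔤^c-valued configurations B defined on 𝔅_k and satisfying (172)."*; p. 307: *"Now we consider another important problem
connected with the function 𝓗(B). In the future we will have to use decay properties of the functional derivative
(δ/δB)𝓗(B). We will prove that this derivative has regularity and decay properties identical to the propagator H, or H₀.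
… The functional derivative (δ/δB)𝓗(B) satisfies a linear equation obtained by differentiations of the equations
determining 𝓗(B)."*, (182) *"(δ/δB)𝓗 = (δ/δB)𝒜₀ + H₀ − H⟨𝔇(𝒜₀ + H₀B), (δ/δB)𝒜₀ + H₀⟩, where the last scalar product is
with respect to bonds in Ω₀ in η-scale"*, then *"Let us denote 𝔄₀(b, c) = (δ/δB(c))𝒜₀(B, b). We may fix a bond c ∈ 𝔅_k
and consider the above equation as an equation for the function 𝔄₀(·, c). This equation can be written as (I +
G̃((δ²/δA′²)V)(𝒜₀ + H₀B))𝔄₀ = G̃Δ^{(2)}H₀ − G̃((δ²/δA′²)V)(𝒜₀ + H₀B)H₀, (184) where the derivative (δ²/δA′²)V is treated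
as a kernel of a linear operator."* — the operator of (184) is evaluated at the configuration 𝒜₀ + H₀B, i.e. AT THE POINT
B (not only at B = 0; XREAD C-lit1g9-11 item (2)); p. 308: (189) *"for supp 𝔄 ⊂ Δ̃(y′), A′ satisfying (77), y ∈ Λ_j"*,
then *"This inequality, the formula (188) and Lemma 2.1, and finally Proposition 2 and (181), yield |(δ/δB_ν(y′))𝓗_μ(B,
x)|, |∇_x(δ/δB_ν(y′))𝓗_μ(B, x)|, ‖ζ∇(δ/δB(y′))𝓗(B)‖_β, |D^{η*}_{U_k}D^η_{U_k}(δ/δB_ν(y))𝓗_μ(B, x)|,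
|Δ^η_{U_k}(δ/δB_ν(y′))𝓗_μ(B, x)| ≤ O(1)[(Lʲη)⁻¹, (Lʲη)⁻², (‖ζ‖^ξ_β + |ζ|)(Lʲη)^{−2−β}, (Lʲη)⁻³, (Lʲη)⁻³]·(L^{j′}η)^{−d}
exp(−⅛δ₀d(y, y′)) (190) for x ∈ Δ(y), or supp ζ ⊂ Δ̃(y), y ∈ Λ_j, y′ ∈ Λ_{j′}."* [typography, XREAD C-b09g9-3 N3: entry 4
of (190) prints (δ/δB_ν(y)) WITHOUT the prime — reproduced as printed (evidently y′, as in the other four entries; entry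
4 is not used here); the superscript of ‖ζ‖ in entry 3 is poorly resolved in the scan and is read ξ by the convention of
[5] p. 397: *"If we use another scale, then it is indicated explicitly by a superscript, e.g. ‖·‖^ξ_α means that
functions and distances are on the ξ-lattice."* (`B11SectG` writes ‖ζ‖^#_β for the same object)]; p. 309, Proposition 9:
*"The minimal configuration U_k(V) = U_k(V′V₀) in the axial gauge has an extension to an analytic function of G^c-valued
small configurations V′ on 𝔅_k. … The function U_k(V′V₀)U_k(V₀)⁻¹ transformed to the Landau gauge is, by the definition,
equal to exp iη𝓗(B), where B = 1/i log V′. The function 𝓗(B) is determined by Eqs. (174), (175), or (179), (180). It is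
an analytic function of B … It satisfies the conditions (19)–(21) with ε₂ = B₅ε₁ (see (173)), and its functional
derivative (182) satisfies the inequalities (190)."* [Balaban1985BackgroundPropagators] p. 397, (3.40): *"‖A‖_{1,α} =
‖∇A‖_α = max_{μ,ν} sup_{x,x′:|x−x′|≤1} |x′ − x|^{−α}|R(U(Γ_{x,x′}))(D_μA_ν)(x′) − (D_μA_ν)(x)|, where Γ_{x,x′} is a
shortest contour connecting points x and x′. It is understood that the η-scale is used in the above definitions."* and
*"Δ̃(y) is a cube of the size 2Lʲη on the lattice T_η, with center at the point y."*  The consumer, [Balaban1987RG1] p.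
275: (3.26) *"M˙(𝐔) = V^v, |V(b) − 1| < O(1)Mα₀, |v − 1| < O(1)Mα₁."*, *"We assume that α₀, α₁ are chosen so that Mα₀,
Mα₁ are still small. We make the next gauge transformation u_{k+1} changing the axial gauge into Landau gauge for the
configuration U_{k+1}(□₀, V), hence U_{k+1}(□₀, V) = (exp iL⁻¹η𝐇_{k+1}(□₀, (1/i) log V))^{u_{k+1}}, |𝐇_{k+1}(□₀, (1/i)
log V)|, |∇^{L⁻¹η}𝐇_{k+1}(□₀, (1/i) log V)|, ‖𝐇_{k+1}(□₀, (1/i) log V)‖_{1,β} < B₃O(1)Mα₀ on □̃⁴, for 0 ≦ β ≦ β₀ < 1,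
|u_{k+1} − 1| < B₃O(1)Mα₀ on □₀. (3.27)"*, for 𝐔 in the COMPLEX space U^c_{k+1}(□₀, (1 + 2β)α₀, (1 + 2β)α₁, α₀) (same
page).

THE PRINTED KERNEL CONVENTION (v1.1; Sect. C and Sect. E of [Balaban1985Variational], renders p011–p013, p022 read as
images by the gen-13 seat; = the evidence E1–E5 of XREAD C-b09g9-3 item (3), used in (R2) below).  p. 287, the
DEFINITION: *"The functional derivative is a kernel of the linear operator acting on functions δA′ and defined as
⟨(δ/δA′)D(A′), δA′⟩ = (d/dτ)D(A′ + τδA′)|_{τ=0}. (63) The functions δA′ are defined at bonds of Ω₀, and values of this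
linear operator are* [p. 288] *functions defined at bonds of 𝔅_k. Let us denote 𝔇(A′; c, b) = (δ/δA′(b))D(A′, c). (64)"*;
p. 288, the PAIRINGS printed with their weights: *"Lʲη(δC_j/δA(b))(Lʲη(A′ − HD(A′)), c) − Lʲη Σ_{b′} η^d
(δC_j/δA(b′))(Lʲη(A′ − HD(A′)), c) Σ_{c′∈𝔅_k} (L^{j′}η)^d H(b′, c′)𝔇(A′; c′, b) = 𝔇(A′; c, b), c ∈ Λ_j, b ∈ Ω₀, (66)"*
(η^d over bonds b′ of Ω₀; (L^{j′}η)^d over c′ ∈ Λ_{j′} ⊂ 𝔅_k for the action of the propagator H through its kernel H(b′,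
c′)) and *"As it is easily seen from (66) this equation is an equation on 𝔇 as a function of the variable c ∈ 𝔅_k. The
variable b is fixed and treated as a parameter."*; p. 288, (69): *"≦ (1/r)C₂(2ε₃ + r sup_{b⊂B^j(c₋)∪B^j(c₊)} Lʲη|H(b,
c′)|)² ≦ (1/r)C₂(2ε₃ + rB₀(L^{j′}η)^{−d}e^{−δ₀d(c₋,c′₋)})² = 9C₂B₀ε₃(L^{j′}η)^{−d}e^{−δ₀d(c₋,c′₋)}, (69) where we have
taken r = ε₃(B₀(L^{j′}η)^{−d}e^{−δ₀d(c₋,c′₋)})⁻¹, c ∈ Λ_j, c′ ∈ Λ_{j′}"* (so the propagator KERNEL obeys Lʲη|H(b, c′)| ≦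
B₀(L^{j′}η)^{−d}e^{−δ₀d(c₋,c′₋)} — exactly the prefactor pattern (Lʲη)⁻¹(L^{j′}η)^{−d}e^{−δ₀d} of (190) entry 1); p. 289:
*"A kernel of the operator (I + ℜ)⁻¹ satisfies the bound |(I + ℜ)⁻¹(c, c′)| ≦ (1 −
9C₂B₀ε₃dc₁(½))⁻¹(L^{j′}η)^{−d}e^{−(1/2)δ₀d(c₋,c′₋)} ≦ 2(L^{j′}η)^{−d}e^{−(1/2)δ₀d(c₋,c′₋)} (71) for ε₃ sufficiently
small, which follows from Lemma 2.1 [3]."* (the 𝔅_k-kernel of a small perturbation of the IDENTITY carries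
(L^{j′}η)^{−d}: in this convention the identity's kernel is (L^{j′}η)^{−d}δ_{c,c′}) and the author's gloss *"Let us
notice that the factor (Lʲη)^{−d} comes from the change of scale: the derivative of C_j has the estimate (157) in [4] on
L^{−j}-scale, and here we consider the derivative on η-scale."*; p. 298, (130): *"|(Δ_{U₀}H_{0,μν})(x, y′)| ≦
B₀(Lʲη)⁻³(L^{j′}η)^{−d}e^{−δ₀d(y,y′)}, x ∈ Δ(y), y ∈ Λ_j, y′ ∈ Λ_{j′}, or |Δ_{U₀}H₀B|_{(−3)} ≦ B₀|B|. (130)"* — the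
paper's own *"or"* between the POINT-KERNEL form carrying (L^{j′}η)^{−d} and the VOLUME-FREE operator form in the
weighted norm |·|_{(−3)} of [5] (3.41).

THE CELL QUESTION AND THE ANSWER OF THIS FILE.  GAPS G-adv5-50/51 record that, for the complex V of (3.26), lines 1–2
of (3.27) are Prop. 9's *"(19)–(21) with ε₂ = B₅ε₁"* (C-adv5-49 (3)) but line 3 (the (1,β)-Hölder seminorm) has *"no
printed producer"*: (19) lists no Hölder entry and [6] Thm 2 (1.36) is a G-valued theorem; five cheap repairs were
refuted there ((a) real slice + analyticity, (b) Cauchy in B′, (c) interpolation from (19), (d) reorganising the p. 288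
remainder, (e) weakening the inductive hypothesis), and the suggested repair is an unprinted re-run of [6] Thm 2's
Hölder derivation for a 𝔤^c-valued field.  THIS FILE points out, and kernel-checks the inference of, a DIFFERENT and
PRINTED route inside Sect. G itself: the LAST clause of Prop. 9 — *"its functional derivative (182) satisfies the
inequalities (190)"* — whose THIRD entry *"‖ζ∇(δ/δB(y′))𝓗(B)‖_β ≤ O(1)(‖ζ‖^ξ_β + |ζ|)(Lʲη)^{−2−β}(L^{j′}η)^{−d}
exp(−⅛δ₀d(y, y′))"* IS a (1,β)-Hölder bound, for the derivative of the analytic 𝓗 at every 𝔤^c-valued B of the domain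
(172) ((184) is posed at the point B; p. 307 l. 1).  Since 𝓗(0) = 0 ((177)) and the domain *"|B′| < 2C₁ε₁ on 𝔅_k"* is
star-shaped about 0, the fundamental theorem of calculus along t ↦ tB, the chain rule (d/dt)𝓗(tB) = ⟨(δ/δB)𝓗(tB), B⟩,
the partition of B into its point values on 𝔅_k and the row sum *"Σ_{y′} exp(−⅛δ₀d(y, y′)) ≤ c"* of Lemma 2.1 [3]
give ‖ζ_y∇𝓗(B)‖_β ≤ O(1)(‖ζ_y‖^ξ_β + |ζ_y|)·c·(Lʲη)^{−2−β}·sup_{𝔅_k}|B| for every block y and every complex B in the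
domain; un-localising (ζ_y ≡ 1 on the core of Δ̃(y); every pair |x − x′| ≤ 1 of the cube is a chain of ≤ N₀(d) pairs
lying in cores) gives the seminorm (3.40) over the cube; with sup|B| = sup|(1/i) log V| ≤ 2·O(1)Mα₀ (as in (172):
|V − 1| < a ⇒ |log V| < 2a) and Lʲη = L^{k+1}·L⁻¹η = 1 on □̃⁴ ⊂ □_{k+1} (B12 p. 273) this is EXACTLY the shape
*"‖𝐇_{k+1}(□₀, (1/i) log V)‖_{1,β} < B₃O(1)Mα₀ on □̃⁴"* — for complex V, with B₃O(1) := 2·N₀·w·C·c (`line3_constant`;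
C = the O(1) of (190), which depends on β₀ < 1 through the propagator constants B₀(β) of [5] Thm 3.1, w = the bump
factor O(1)(‖ζ‖^ξ_β + |ζ|) at scale 1).  None of the refuted repairs (a)–(e) is used: the Hölder information is not
interpolated, transported from the real slice or extracted by Cauchy estimates — it is PRINTED, as the Hölder entry of
the derivative's decay estimate, and integrated.  The same two lines with `bout` := the sup-sizes and entries 1–2 of
(190) re-derive lines 1–2 of (3.27) for complex V inside Sect. G (a second producer next to C-adv5-49 (3)'s (19)).

WHAT IS PROVED (sorry-free; axioms propext / Classical.choice / Quot.sound).
 §1 `exists_linear_eq_seminorm_le` (Hahn–Banach norming functional of a seminorm: φ v = p v, |φ| ≤ p) and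
    `seminorm_image_sub_le_of_deriv_le_segment_01` — the MEAN-VALUE MAJORANT FOR A SEMINORM p ≤ M‖·‖ on a real normed
    space: HasDerivWithinAt γ (γ′ t) [0,1] t and p(γ′ t) ≤ K on [0,1) ⇒ p(γ 1 − γ 0) ≤ K.  [folklore]
 §2 `locSeminorm` (an absolutely homogeneous local size of a `BlockNorm` is a `Seminorm`), `loc_apply_le_of_ineq190`
    (a (190)-type majorant `Ineq190 bB bout T C δ₀` + `RowSum g (δ₀/8) c` + all local sizes of B ≤ s ⇒ bout.loc y (T B)
    ≤ C·κ_B·c·s — `HasMaj.bound` + the row sum) and `loc_le_of_ineq190_segment`: 𝓗 0 = 0, the path s ↦ 𝓗(sB)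
    differentiable on [0,1] with derivative dH t B, `Ineq190 bB bout (dH t) C δ₀` for t ∈ [0,1), row sum, sizes of B
    ≤ s ⇒ bout.loc y (𝓗 B) ≤ C·κ_B·c·s for every block y.
 §3 `HolderOn ρ β P u C` (*"‖u x′ − u x‖ ≤ C·ρ(x,x′)^β on the pairs P"* — the seminorm (3.40) restricted to a pair
    set), `HolderOn.mono`, `HolderOn.of_chains` (chains of ≤ N links in local families ⇒ constant N·C; telescoping).
 §4 `holderOn_grad_of_ineq190_segment` — §2 + §3 assembled: the (1,β)-seminorm of grad(𝓗 B) over the pair set P is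
    ≤ N·(w·(C·κ_B·c·s)); `line3_constant` — with κ_B = 1, s = 2a the constant is (2NwCc)·a, *"B₃O(1)·Mα₀"*.

HONEST SCOPE — what this file does NOT establish, and the residual ledger of the certificates C-B11-G12a / C-B11-G13a.
 (R0) Nothing printed is asserted.  The theorems are inferences; their displayed hypotheses are, one for one, the
      printed inputs: `h190` = Prop. 9's last clause at the points tB, t ∈ [0,1) (all in the domain (172) when B is:
      |tB| ≤ |B|); `h0` = (177); `hpath` = differentiability of the analytic 𝓗 along the segment with derivative the
      pairing of (δ/δB)𝓗(tB) with B (finite lattice 𝔅_k, so `FB`, `FA` are finite-dimensional and every size is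
      dominated by a norm — hypotheses `hhom`, `hM`); `hrow` = the row sum (2.61) of Lemma 2.1 [3] at rate ⅛δ₀
      with an ABSTRACT constant c (the printed c₁(α) is refuted as typed for d ≥ 3, GAPS G-A11-1,
      `B6Lemma21Counterexample`; consumers bind the repaired constants of `B6Lemma21Repaired` / `B6Lemma21TwoScale` —
      this file is indifferent to which); `hs` = the radius;
      `hdom`, `hchain` = the bump / chain geometry (R3).
 (R1) UPSTREAM STATUS (inherited, not new).  (190) rests on (189), whose derivation the author omits (p. 308: *"We do
      not perform these calculations here … let us formulate a final result only"*) — GAPS G-B11-G2 (KEY) — and on the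
      words *"and finally Proposition 2 and (181)"* — G-B11-G2a; `B11SectG` kernel-checks the bookkeeping (189) + (188)
      + Lemma 2.1 ⇒ (190) and records both.  So (3.27) line 3 for complex V has, by this file, the SAME pedigree as every
      other use of (190) in [Balaban1987RG1] ((3.9), (3.17), (3.32), (4.5)): PRINTED modulo G-B11-G2 / G2a.  G-adv5-50's
      *"no printed producer"* is thereby reduced to an already-catalogued KEY omission; no NEW unprinted clause remains
      on the B11 side of line 3.
 (R2) KERNEL NORMALISATION = THE PRINTED CONVENTION (v1 graded this «interpretive, LOW»; v1.1: CONFIRMED FROM PRINT and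
      the alternative EXCLUDED — XREAD C-b09g9-3 item (3), evidence E1–E6; = `B11SectG` module docstring, reading (a)).
      (190) bounds the derivative at a POINT y′ ∈ Λ_{j′} and carries (L^{j′}η)^{−d}; `Ineq190` reads (δ/δB_ν(y′)) as the
      kernel of the differential with respect to the (L^{j′}η)^d-weighted pairing on 𝔅_k of (66) p. 288 (a point c′ ∈
      Λ_{j′} ⊂ 𝔅_k weighs (L^{j′}η)^d, lengths in η-scale), so that ∂𝓗/∂B_ν(y′) = (L^{j′}η)^d·(δ/δB_ν(y′))𝓗 obeys the
      volume-free operator bound C·e^{−⅛δ₀d} of `Ineq190`, and the chain rule (d/dt)𝓗(tB) = ⟨(δ/δB)𝓗(tB), B⟩ =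
      Σ_{y′,ν}(L^{j′}η)^d B_ν(y′)(δ/δB_ν(y′))𝓗(tB) — the pairing of the definition (63) — cancels the factor identically,
      leaving for Lemma 2.1 the bare Σ_{y′∈𝔅_k} e^{−⅛δ₀d(y,y′)} = `RowSum`.  PRINTED EVIDENCE (the passages are quoted
      above under THE PRINTED KERNEL CONVENTION and WHAT IS PRINTED): E1 — (63) p. 287, the DEFINITION: a functional
      derivative is, in this paper, the kernel of the Gâteaux differential with respect to the scalar product ⟨·,·⟩, the
      differential being recovered by PAIRING the kernel with the direction; E2 — (66) p. 288, the pairings printed WITH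
      their weights, η^d over bonds of Ω₀ (= (182)'s *"scalar product … with respect to bonds in Ω₀ in η-scale"*) and
      (L^{j′}η)^d over c′ ∈ Λ_{j′} ⊂ 𝔅_k for the action of the propagator H through its kernel; E3 — (71) p. 289: the
      𝔅_k-kernel of an operator that is a small perturbation of the IDENTITY carries (L^{j′}η)^{−d} (the identity's
      kernel is (L^{j′}η)^{−d}δ_{c,c′} in this convention — the cleanest witness that (L^{j′}η)^{−d} in a 𝔅_k-kernel is
      pairing normalisation and nothing else), with (69) p. 288: Lʲη|H(b, c′)| ≦ B₀(L^{j′}η)^{−d}e^{−δ₀d}, the prefactor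
      pattern (Lʲη)⁻¹(L^{j′}η)^{−d}e^{−δ₀d} of (190) entry 1 — p. 307's *"regularity and decay properties identical to
      the propagator H, or H₀"* is literally true entry by entry in this convention; E4 — the author's gloss p. 289 *"the
      factor (Lʲη)^{−d} comes from the change of scale …"*: the power of the scale in a derivative kernel is set by the
      scale of the pairing with respect to which the derivative is taken; E5 — (130) p. 298: the paper itself equates
      (*"or"*) the point-kernel form WITH (L^{j′}η)^{−d} and the volume-free operator form |Δ_{U₀}H₀B|_{(−3)} ≦ B₀|B|
      (testing B = the unit configuration at one y′ ∈ Λ_{j′} gives (H₀B)(x) = (L^{j′}η)^d H₀(x, y′) under E2's pairing,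
      so the operator form returns the kernel form with precisely the printed prefactor; conversely kernel ⇒ operator is
      Lemma 2.1 after the weights cancel); E6 — (182)–(184) p. 307: (δ/δB)𝓗 = (δ/δB)𝒜₀ + H₀ − … adds the δ/δB-kernel of
      𝒜₀ to the OPERATOR H₀, and (184) is solved for 𝔄₀(·, c), c ∈ 𝔅_k fixed, against the columns of H₀'s kernel — so the
      kernels (δ/δB_ν(y′))(·) of Sect. G live in H₀'s kernel convention, which E2/E5 fix as the (L^{j′}η)^d-weighted one.
      B9-side cross-check ([5], the same convention): the VOLUME-FREE operator form (3.42) *"|(G′(U)λ)(x)| … ≤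
      B₀[…]e^{−δ₀d(y,y′)}|λ| for x ∈ Δ(y), y ∈ Λ_j, supp λ ⊂ Δ(y′)"* — identical decay for a POINT kernel forces the
      (L^{j′}η)^{−d} of a scale-normalised kernel.  THE UNWEIGHTED READING IS EXCLUDED, not merely disfavoured: under it
      (71) and the *"or"* of (130) would be false as printed, and the inference of this file would NOT follow from (190)
      + Lemma 2.1 — the factor (L^{j′}η)^{−d} ≥ 1 would survive inside the Lemma 2.1 sum, and
      Σ_{y′∈Λ_{j′}}(L^{j′}η)^{−d}e^{−⅛δ₀d(y,y′)} ≳ L^{(k−j′)d} is not bounded uniformly in η for j′ < k (one would need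
      ⅛δ₀ × (layer separation in d-units) > d log L per scale step).  That is why the reading is load-bearing and why it
      is recorded; residual on the reading: NONE (C-b09g9-3).  What remains upstream of `h190` is (R1), unchanged.
 (R3) GEOMETRY (elementary, not printed, definitional).  `hdom`: with ζ_y ∈ C₀^∞(Δ̃(y)), ζ_y ≡ 1 on the core cube of
      side (7/4)Lʲη, the localised quotient of entry 3 of (190) equals the plain quotient of (3.40) on core pairs, weight
      w = O(1)(‖ζ_y‖^ξ_β + |ζ_y|)(Lʲη)^{−2−β} (= O(1) at scale Lʲη = 1); `hchain`: on the η-lattice every pair x, x′ of a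
      cube with |x − x′| ≤ 1 ≤ Lʲη is joined by a lattice path of ≤ N₀(d) sub-pairs, each inside the core of the block
      of one of its points and not longer than |x − x′| (a single bump per pair fails exactly for pairs straddling a block
      face at distance 1 — whence chains).  The parallel transports R(U(Γ_{x,x′})) of (3.40) are absorbed in the abstract
      `grad`/norm of §3–§4 (at the consumer U = U_k(V₀) = 1, C-adv5-49 (3)).
 (R4) RADIUS (consumer bookkeeping, = C-adv5-49 (3)(a) / S-B12.9).  The segment {tB : 0 ≤ t ≤ 1} lies in (172) iff sup|B|
      < 2C₁ε₁ (STRICT: B itself in the OPEN ball — which is also what makes `hpath` hold at the endpoint t = 1 within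
      [0,1]: the closed segment lies inside the domain of analyticity, so the one-sided derivative at t = 1 exists; XREAD
      C-lit1g9-11 R2); with |V − 1| < O(1)Mα₀ this is the clause O(1)Mα₀ ≦ C₁ε₁, ε₁ ≦ a₁ of the consumer lineages; `hs`
      displays s.
 (R5) NOT the identification of B12's 𝐇_{k+1}(□₀, (1/i) log V) with 𝓗(B) at V₀ = 1 on B12's p. 273 sequence (that is
      C-adv5-49 (1)–(3), adv5's certificate), NOT the β₀-dependence of the O(1) of (190) beyond "a constant for each β₀ <
      1" (the propagator constants B₀(β) → ∞ as β → 1, [5] Thm 3.1 — consistent with (3.27)'s "0 ≦ β ≦ β₀ < 1"), and NOT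
      any statement of [Balaban1987RG1].

MODELLING CONVENTIONS (DIVERGENCE D-B11-22).  (i) Fields and data are vectors of real normed spaces `FA`, `FB` (the
𝔤^c-valued lattice functions on the finite region / on 𝔅_k, any norm); sizes are `B11SectG.BlockNorm`s over the abstract
multiscale carrier `B6.Geometry` (𝔅 = `g.Site`, d(y,y′) = `g.dist`).  (ii) The functional derivative at the point tB is
an ℝ-linear operator `dH t : FB →ₗ[ℝ] FA` on directions (the complex-linear structure is not needed for an upper bound);
(190) at that point = `Ineq190 bB bout (dH t) C δ₀` (the printed kernel convention (63)/(66), R2).  (iii) The Hölder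
local size is any `bout.loc y` that is subadditive (structure field), absolutely homogeneous (`hhom`) and norm-dominated
(`hM`); its link to pair quotients is the displayed `hdom`.  (iv) The seminorm (3.40) over a region is `HolderOn ρ β P u
C` with P the admissible pairs (|x − x′| ≤ 1, both points in the cube), ρ the η-scale distance, u = grad f valued in a
real normed group `G` (parallel transports inside u / the norm).  (v) Every O(1) is an explicit real parameter (C, c, w,
κ_B, N, s) and the final constant is displayed by `line3_constant`.
-/

namespace Literature.MathematicalPhysics.QuantumFieldTheory.Balaban1983to89.B11HolderComplex

open Set

/-! ## §1  Mean-value majorant for a seminorm dominated by the norm (folklore) -/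

section MeanValue

variable {F : Type*} [NormedAddCommGroup F] [NormedSpace ℝ F]

/-- Hahn–Banach norming functional for a seminorm: for every `v` there is an ℝ-linear functional `φ` with
`φ v = p v` and `|φ x| ≤ p x` for all `x`. [folklore] -/
theorem exists_linear_eq_seminorm_le (p : Seminorm ℝ F) (v : F) :
    ∃ φ : F →ₗ[ℝ] ℝ, φ v = p v ∧ ∀ x, |φ x| ≤ p x := by
  by_cases hv : v = 0
  · refine ⟨0, ?_, fun x => ?_⟩
    · simp [hv]
    · simp [apply_nonneg p x]
  · let f : F →ₗ.[ℝ] ℝ := LinearPMap.mkSpanSingleton v (p v) hv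
    have hfN : ∀ x : f.domain, f x ≤ p x := by
      rintro ⟨x, hx⟩
      obtain ⟨c, rfl⟩ := Submodule.mem_span_singleton.1 hx
      rw [LinearPMap.mkSpanSingleton'_apply]
      simp only [RingHom.id_apply, smul_eq_mul, map_smul_eq_mul, Real.norm_eq_abs]
      exact mul_le_mul_of_nonneg_right (le_abs_self c) (apply_nonneg p v)
    obtain ⟨φ, hφ₁, hφ₂⟩ := exists_extension_of_le_sublinear f p
      (fun c hc x => by rw [map_smul_eq_mul, Real.norm_eq_abs, abs_of_pos hc])
      (fun x y => map_add_le_add p x y) hfN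
    refine ⟨φ, ?_, fun x => ?_⟩
    · have h := hφ₁ ⟨v, Submodule.mem_span_singleton_self v⟩
      rw [h]
      exact LinearPMap.mkSpanSingleton'_apply_self _ _ _ _
    · rw [abs_le]
      refine ⟨?_, hφ₂ x⟩
      have h := hφ₂ (-x)
      rw [map_neg, map_neg_eq_map] at h
      linarith

/-- **Mean-value majorant for a seminorm.**  If `p` is a seminorm dominated by (a multiple of) the norm, `γ` has
derivative `γ′ t` within `[0,1]` at every `t ∈ [0,1]`, and `p (γ′ t) ≤ K` on `[0,1)`, then `p (γ 1 − γ 0) ≤ K`.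
Proof: a Hahn–Banach functional `φ` norming `γ 1 − γ 0` for `p` is continuous (|φ| ≤ p ≤ M‖·‖), and the scalar
function `φ ∘ γ` has derivative `φ (γ′ t)` of absolute value ≤ K (`norm_image_sub_le_of_norm_deriv_le_segment_01'`).
[folklore] -/
theorem seminorm_image_sub_le_of_deriv_le_segment_01 (p : Seminorm ℝ F) {M : ℝ} (hpM : ∀ x, p x ≤ M * ‖x‖)
    {γ γ' : ℝ → F} (hγ : ∀ t ∈ Icc (0 : ℝ) 1, HasDerivWithinAt γ (γ' t) (Icc (0 : ℝ) 1) t) {K : ℝ}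
    (hK : ∀ t ∈ Ico (0 : ℝ) 1, p (γ' t) ≤ K) : p (γ 1 - γ 0) ≤ K := by
  obtain ⟨φ, hφv, hφle⟩ := exists_linear_eq_seminorm_le p (γ 1 - γ 0)
  let φL : F →L[ℝ] ℝ := φ.mkContinuous M fun x => by
    rw [Real.norm_eq_abs]
    exact (hφle x).trans (hpM x)
  have hφL : ∀ x, φL x = φ x := fun x => rfl
  have hderiv : ∀ t ∈ Icc (0 : ℝ) 1, HasDerivWithinAt (fun s => φL (γ s)) (φL (γ' t)) (Icc (0 : ℝ) 1) t :=
    fun t ht => φL.hasFDerivAt.comp_hasDerivWithinAt t (hγ t ht)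
  have hbound : ∀ t ∈ Ico (0 : ℝ) 1, ‖φL (γ' t)‖ ≤ K := fun t ht => by
    rw [hφL, Real.norm_eq_abs]
    exact (hφle _).trans (hK t ht)
  have h := norm_image_sub_le_of_norm_deriv_le_segment_01' hderiv hbound
  rw [hφL, hφL, ← map_sub, Real.norm_eq_abs, hφv] at h
  exact (le_abs_self _).trans h

end MeanValue

/-! ## §2  (190) along the segment t ↦ tB: the block size of 𝓗(B) from the majorant of its derivative -/

section Segment

open B11SectG

variable {g : B6.Geometry}
variable {FB FA : Type} [NormedAddCommGroup FB] [NormedSpace ℝ FB] [NormedAddCommGroup FA] [NormedSpace ℝ FA]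

/-- A local size `bout.loc y` which is absolutely homogeneous is a seminorm (subadditivity is part of `BlockNorm`).
[folklore] -/
def locSeminorm (bout : BlockNorm g FA) (y : g.Site)
    (hhom : ∀ (a : ℝ) (f : FA), bout.loc y (a • f) = |a| * bout.loc y f) : Seminorm ℝ FA :=
  Seminorm.of (bout.loc y) (bout.loc_add_le y) fun a f => by rw [hhom, Real.norm_eq_abs]

/-- `locSeminorm` is the local size. [folklore] -/
@[simp] theorem locSeminorm_apply (bout : BlockNorm g FA) (y : g.Site)
    (hhom : ∀ (a : ℝ) (f : FA), bout.loc y (a • f) = |a| * bout.loc y f) (f : FA) :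
    locSeminorm bout y hhom f = bout.loc y f := rfl

/-- USE of a (190)-type majorant on the datum B itself: if the linear operator `T` (here: the derivative
(δ/δB)𝓗 at some point of the segment, as an operator on directions) has majorant C·e^{−(δ₀/8)d(y,y′)} from the
B-size to the local size `bout`, the multiscale row sum *"Σ_{y′} e^{−(δ₀/8)d(y,y′)} ≤ c"* holds (Lemma 2.1 [3],
`B11SectG.RowSum`) and every local size of B is ≤ s, then `bout.loc y (T B) ≤ C·κ_B·c·s` — the partition of unity of
the B-space (`HasMaj.bound`) followed by the row sum. [cite: Balaban1985Variational, (190) p.308;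
Balaban1984PropagatorsII, Lemma 2.1 (2.61) p.234] -/
theorem loc_apply_le_of_ineq190 (bB : BlockNorm g FB) (bout : BlockNorm g FA) {T : FB →ₗ[ℝ] FA}
    {C δ₀ c s : ℝ} (hC : 0 ≤ C) (h190 : Ineq190 bB bout T C δ₀) (hrow : RowSum g (δ₀ / 8) c)
    {B : FB} (hs : ∀ y', bB.loc y' B ≤ s) (y : g.Site) : bout.loc y (T B) ≤ C * bB.κ * c * s := by
  have hK : ∀ a b : g.Site, 0 ≤ C * Real.exp (-(δ₀ / 8 * g.dist a b)) :=
    fun a b => mul_nonneg hC (Real.exp_pos _).le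
  have hs0 : 0 ≤ s := (bB.loc_nonneg y B).trans (hs y)
  have h1 := HasMaj.bound h190 hK B y
  calc bout.loc y (T B)
      ≤ ∑ y' : g.Site, C * Real.exp (-(δ₀ / 8 * g.dist y y')) * (bB.κ * bB.loc y' B) := h1
    _ ≤ ∑ y' : g.Site, C * Real.exp (-(δ₀ / 8 * g.dist y y')) * (bB.κ * s) :=
        Finset.sum_le_sum fun y' _ =>
          mul_le_mul_of_nonneg_left (mul_le_mul_of_nonneg_left (hs y') bB.κ_nonneg) (hK _ _)
    _ = C * bB.κ * s * ∑ y' : g.Site, Real.exp (-(δ₀ / 8 * g.dist y y')) := by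
        rw [Finset.mul_sum]
        refine Finset.sum_congr rfl fun y' _ => ?_
        ring
    _ ≤ C * bB.κ * s * c :=
        mul_le_mul_of_nonneg_left (hrow y) (mul_nonneg (mul_nonneg hC bB.κ_nonneg) hs0)
    _ = C * bB.κ * c * s := by ring

/-- **The Hölder entry of (190), integrated.**  Setting of Prop. 9 p. 309 / Sect. G pp. 305–308 of
[Balaban1985Variational], every analytic input DISPLAYED as a hypothesis:
* `𝓗 : FB → FA` — the analytic minimiser field B ↦ 𝓗(B) on the ball (172) *"|B′| < 2C₁ε₁ on 𝔅_k"* (𝔤^c-valued B,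
  p. 307 l. 1), with `h0 : 𝓗 0 = 0` (Prop. 9: at V′ = 1 the configuration U_k(V₀)U_k(V₀)⁻¹ = 1 has Landau-gauge
  logarithm 0; (177) p. 306: *"the expansion of 𝓗 begins with the first order term H₁B"*);
* `dH t` — its derivative at the point tB of the segment, as an ℝ-linear operator on directions, with `hpath`: the
  path s ↦ 𝓗(sB) has derivative `dH t B` at every t ∈ [0,1] (chain rule for the analytic, hence differentiable, 𝓗 on
  the star-shaped ball; finite lattice, so no topology is hidden; t = 1 included because B itself lies in the OPEN ball —
  the strict radius clause (R4), sup|B| < 2C₁ε₁ — so the closed segment lies inside the domain of analyticity);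
* `h190 : ∀ t ∈ [0,1), Ineq190 bB bout (dH t) C δ₀` — Prop. 9's last clause *"its functional derivative (182) satisfies
  the inequalities (190)"* at every point of the segment (all of which lie in the ball; that (190) is asserted at every B
  of (172) and not only at B = 0 is printed: the derivative equations are posed at the general point — (184) *"(I +
  G̃((δ²/δA′²)V)(𝒜₀ + H₀B))𝔄₀ = G̃Δ^{(2)}H₀ − G̃((δ²/δA′²)V)(𝒜₀ + H₀B)H₀"* has its operator evaluated at the
  configuration 𝒜₀ + H₀B — and Prop. 9's last sentence is unqualified; XREAD C-lit1g9-11 item (2)), in the cell's typed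
  form `B11SectG.Ineq190` (majorant C·e^{−⅛δ₀d(y,y′)} from the B-size into the local size `bout`; with `bout.loc y` =
  (L^jη)^{2+β}(O(1)(‖ζ_y‖^ξ_β + |ζ_y|))⁻¹‖ζ_y∇ · ‖_β for y ∈ Λ_j and a fixed bump ζ_y ⊂ Δ̃(y) this IS entry 3 of (190),
  *"‖ζ∇(δ/δB(y′))𝓗(B)‖_β ≤ O(1)(‖ζ‖^ξ_β + |ζ|)(L^jη)^{−2−β}(L^{j′}η)^{−d}exp(−⅛δ₀d(y,y′))"*, the factor (L^{j′}η)^{−d}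
  being the normalisation of the kernel w.r.t. the (L^{j′}η)^d-weighted pairing on 𝔅_k of (66) p. 288 — the PRINTED
  convention (63)/(66)/(69)/(71)/(130), header (R2), `B11SectG` module docstring (a); it cancels against the weight of
  the same pairing in the chain rule, leaving the bare row sum of Lemma 2.1);
* `hrow : RowSum g (δ₀/8) c` — Lemma 2.1 (2.61) of [3];  `hs` — every local size of B is ≤ s (s = 2C₁ε₁ in (172); in
  [Balaban1987RG1] (3.26)–(3.27): |V − 1| < O(1)Mα₀, so s = 2·O(1)Mα₀);
* `hhom`, `hM` — the local size at y is absolutely homogeneous and dominated by the norm of `FA` (true for every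
  sup / Hölder size on a finite lattice).
CONCLUSION: `bout.loc y (𝓗 B) ≤ C·κ_B·c·s` — for the Hölder size: ‖ζ_y∇𝓗(B)‖_β ≤ O(1)(‖ζ_y‖^ξ_β + |ζ_y|)·C·κ_B·c·
(L^jη)^{−2−β}·s, the SHAPE of [Balaban1987RG1] (3.27) line 3 (there L^jη = 1 on □̃⁴ ⊂ □_{k+1} and s = 2·O(1)Mα₀).
Proof = `loc_apply_le_of_ineq190` at every t + the mean-value majorant `seminorm_image_sub_le_of_deriv_le_segment_01`.
Nothing printed is asserted: (190) ⇐ (189) is the author-omitted calculation (cell GAPS G-B11-G2) and enters ONLY as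
the hypothesis `h190`. [cite: Balaban1985Variational, Prop. 9 p.309 + (172) p.305 + (190) p.308;
Balaban1987RG1, (3.26)-(3.27) p.275] -/
theorem loc_le_of_ineq190_segment (bB : BlockNorm g FB) (bout : BlockNorm g FA) (y : g.Site)
    (hhom : ∀ (a : ℝ) (f : FA), bout.loc y (a • f) = |a| * bout.loc y f)
    {M : ℝ} (hM : ∀ f : FA, bout.loc y f ≤ M * ‖f‖)
    (𝓗 : FB → FA) (h0 : 𝓗 0 = 0) (B : FB) (dH : ℝ → (FB →ₗ[ℝ] FA))
    (hpath : ∀ t ∈ Icc (0 : ℝ) 1, HasDerivWithinAt (fun s : ℝ => 𝓗 (s • B)) (dH t B) (Icc (0 : ℝ) 1) t)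
    {C δ₀ c s : ℝ} (hC : 0 ≤ C) (h190 : ∀ t ∈ Ico (0 : ℝ) 1, Ineq190 bB bout (dH t) C δ₀)
    (hrow : RowSum g (δ₀ / 8) c) (hs : ∀ y', bB.loc y' B ≤ s) :
    bout.loc y (𝓗 B) ≤ C * bB.κ * c * s := by
  have hK : ∀ t ∈ Ico (0 : ℝ) 1, locSeminorm bout y hhom (dH t B) ≤ C * bB.κ * c * s := fun t ht => by
    rw [locSeminorm_apply]
    exact loc_apply_le_of_ineq190 bB bout hC (h190 t ht) hrow hs y
  have h := seminorm_image_sub_le_of_deriv_le_segment_01 (locSeminorm bout y hhom) hM hpath hK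
  simpa [one_smul, zero_smul, h0] using h

end Segment

/-! ## §3  Un-localisation: a Hölder seminorm over pairs from localised Hölder bounds (folklore) -/

section Unlocalise

variable {X G : Type*} [NormedAddCommGroup G]

/-- *"‖u‖ restricted to the pairs P is ≤ C"*: for every pair (x, x′) with `P x x'`, ‖u x′ − u x‖ ≤ C·ρ(x,x′)^β
(ρ = the distance, β = the Hölder exponent; [Balaban1985BackgroundPropagators] (3.40) p. 397: *"‖A‖_{1,α} =
‖∇A‖_α = max sup_{x,x′:|x−x′|≤1} |x′ − x|^{−α}|R(U(Γ_{x,x′}))(D_μA_ν)(x′) − (D_μA_ν)(x)|"* — the pairs of the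
norm are those with |x − x′| ≤ 1). [cite: Balaban1985BackgroundPropagators, (3.40) p.397] -/
def HolderOn (ρ : X → X → ℝ) (β : ℝ) (P : X → X → Prop) (u : X → G) (C : ℝ) : Prop :=
  ∀ x x', P x x' → ‖u x' - u x‖ ≤ C * ρ x x' ^ β

/-- Monotonicity of `HolderOn` in the constant (ρ ≥ 0). [folklore] -/
theorem HolderOn.mono {ρ : X → X → ℝ} {β : ℝ} {P : X → X → Prop} {u : X → G} {C C' : ℝ}
    (h : HolderOn ρ β P u C) (hρ : ∀ x x', 0 ≤ ρ x x') (hCC' : C ≤ C') : HolderOn ρ β P u C' :=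
  fun x x' hP => (h x x' hP).trans (mul_le_mul_of_nonneg_right hCC' (Real.rpow_nonneg (hρ x x') β))

/-- **Chains.**  If every pair of `P` is joined by a chain x = z₀, z₁, …, z_n = x′ of at most N links, each link being
a pair of some LOCAL family `Q i` (i ∈ ι: *"supp ζ ⊂ Δ̃(y)"*, the pairs inside the core of the bump ζ_y) and not
longer than the pair itself, and `u` is (C, β)-Hölder on every local family, then `u` is (N·C, β)-Hölder on `P`
(telescoping sum).  This is the passage from the localised third entry of (190) (one bump ζ per block Δ̃(y)) to the
un-localised norm ‖·‖_{1,β} *"on □̃⁴"* of [Balaban1987RG1] (3.27); on a lattice cube, pairs with |x − x′| ≤ 1 are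
joined by N ≤ N₀(d) sub-pairs each inside the core of one of the bumps. [folklore] -/
theorem HolderOn.of_chains {ρ : X → X → ℝ} {β : ℝ} (hβ : 0 ≤ β) (hρ : ∀ x x', 0 ≤ ρ x x')
    {ι : Type*} {Q : ι → X → X → Prop} {P : X → X → Prop} {N : ℕ}
    (hchain : ∀ x x', P x x' → ∃ (n : ℕ) (z : ℕ → X), n ≤ N ∧ z 0 = x ∧ z n = x' ∧
      ∀ i < n, (∃ k, Q k (z i) (z (i + 1))) ∧ ρ (z i) (z (i + 1)) ≤ ρ x x')
    {u : X → G} {C : ℝ} (hC : 0 ≤ C) (hloc : ∀ k, HolderOn ρ β (Q k) u C) :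
    HolderOn ρ β P u (N * C) := by
  intro x x' hP
  obtain ⟨n, z, hn, hz0, hzn, hlink⟩ := hchain x x' hP
  have htel : u x' - u x = ∑ i ∈ Finset.range n, (u (z (i + 1)) - u (z i)) := by
    rw [Finset.sum_range_sub (fun i => u (z i)) n, hz0, hzn]
  have hstep : ∀ i ∈ Finset.range n, ‖u (z (i + 1)) - u (z i)‖ ≤ C * ρ x x' ^ β := by
    intro i hi
    obtain ⟨⟨k, hk⟩, hρi⟩ := hlink i (Finset.mem_range.mp hi)
    exact ((hloc k) _ _ hk).trans
      (mul_le_mul_of_nonneg_left (Real.rpow_le_rpow (hρ _ _) hρi hβ) hC)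
  calc ‖u x' - u x‖ = ‖∑ i ∈ Finset.range n, (u (z (i + 1)) - u (z i))‖ := by rw [htel]
    _ ≤ ∑ i ∈ Finset.range n, ‖u (z (i + 1)) - u (z i)‖ := norm_sum_le _ _
    _ ≤ ∑ i ∈ Finset.range n, C * ρ x x' ^ β := Finset.sum_le_sum hstep
    _ = n * (C * ρ x x' ^ β) := by rw [Finset.sum_const, Finset.card_range, nsmul_eq_mul]
    _ ≤ N * (C * ρ x x' ^ β) :=
        mul_le_mul_of_nonneg_right (Nat.cast_le.mpr hn) (mul_nonneg hC (Real.rpow_nonneg (hρ _ _) β))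
    _ = N * C * ρ x x' ^ β := by ring

end Unlocalise

/-! ## §4  The dictionary: (190) entry 3 along the segment + chains ⇒ the shape of (3.27) line 3 -/

section Line3

open B11SectG

variable {g : B6.Geometry}
variable {FB FA : Type} [NormedAddCommGroup FB] [NormedSpace ℝ FB] [NormedAddCommGroup FA] [NormedSpace ℝ FA]
variable {X G : Type*} [NormedAddCommGroup G]

/-- **[Balaban1987RG1] (3.27) line 3 for complex data, from the printed Sect. G of [Balaban1985Variational] — the
inference, kernel-checked; every analytic input displayed.**  Printed consumer (p. 275, render read as image):
*"|𝐇_{k+1}(□₀, (1/i) log V)| , |∇𝐇_{k+1}(□₀, (1/i) log V)|, ‖𝐇_{k+1}(□₀, (1/i) log V)‖_{1,β} < B₃O(1)Mα₀ on □̃⁴,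
for 0 ≤ β ≤ β₀ < 1"* ((3.27) lines 1–3), for the COMPLEX V of (3.26) *"|V(b) − 1| < O(1)Mα₀"*; the cell (GAPS
G-adv5-50/51, C-adv5-49 (3)) identified 𝐇_{k+1}(□₀, (1/i) log V) with Prop. 9's analytic 𝓗(B), B = (1/i) log V, at
V₀ = 1, found lines 1–2 printed ((19) of [6] Thm 2 at ε₂ = B₅ε₁) and recorded *"no printed producer"* for line 3.
THIS THEOREM is the B11-side producer: in the setting of `loc_le_of_ineq190_segment` (Prop. 9 + (172) + (190) +
Lemma 2.1, see there), let `grad f : X → G` be the (covariant) gradient of the field f read as a function on the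
η-lattice points X of the region, ρ the distance and β ≥ 0 the exponent of the norm (3.40) of
[Balaban1985BackgroundPropagators], `Q y` the pairs inside the core of the bump ζ_y (where ζ_y ≡ 1, so that the
localised Hölder quotient of entry 3 of (190) IS the plain quotient: hypothesis `hdom`, with the weight
w = O(1)(‖ζ_y‖^ξ_β + |ζ_y|)·(L^jη)^{−2−β}, uniform over the blocks y meeting the cube — in (3.27) all of them have
L^jη = L^{k+1}ξ = 1 since □̃⁴ ⊂ □_{k+1}), and `P` the pairs of the cube with ρ ≤ 1, each joined by a chain of ≤ N
links lying in cores (`hchain`; on a lattice cube N ≤ N₀(d) with cores of radius ⅞L^jη).  CONCLUSION: the (1,β)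
seminorm of 𝓗(B) over the pairs P is ≤ N·w·C·κ_B·c·s — with s = 2·O(1)Mα₀ this is *"‖𝐇_{k+1}‖_{1,β} <
B₃O(1)Mα₀ on □̃⁴"*, every O(1) explicit: N (geometry), w (bump, scale 1), C (the O(1) of (190)), κ_B (= 1 for the
point blocks of 𝔅_k), c (Lemma 2.1 row sum at rate ⅛δ₀), 2 (log vs. V − 1).  Nothing printed is asserted; the
disputed inputs are the hypotheses `h190` ((190) ⇐ (189), author-omitted: GAPS G-B11-G2; transport words G-B11-G2a)
and the identification of the consumer's object (C-adv5-49 (3)). [cite: Balaban1987RG1, (3.26)-(3.27) p.275;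
Balaban1985Variational, Prop. 9 p.309 + (190) p.308; Balaban1985BackgroundPropagators, (3.40) p.397;
Balaban1984PropagatorsII, Lemma 2.1 (2.61) p.234] -/
theorem holderOn_grad_of_ineq190_segment (hne : Nonempty g.Site) (bB : BlockNorm g FB) (bout : BlockNorm g FA)
    (hhom : ∀ (y : g.Site) (a : ℝ) (f : FA), bout.loc y (a • f) = |a| * bout.loc y f)
    {M : ℝ} (hM : ∀ (y : g.Site) (f : FA), bout.loc y f ≤ M * ‖f‖)
    (𝓗 : FB → FA) (h0 : 𝓗 0 = 0) (B : FB) (dH : ℝ → (FB →ₗ[ℝ] FA))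
    (hpath : ∀ t ∈ Icc (0 : ℝ) 1, HasDerivWithinAt (fun s : ℝ => 𝓗 (s • B)) (dH t B) (Icc (0 : ℝ) 1) t)
    {C δ₀ c s : ℝ} (hC : 0 ≤ C) (h190 : ∀ t ∈ Ico (0 : ℝ) 1, Ineq190 bB bout (dH t) C δ₀)
    (hrow : RowSum g (δ₀ / 8) c) (hs : ∀ y', bB.loc y' B ≤ s)
    (grad : FA → X → G) (ρ : X → X → ℝ) {β : ℝ} (hβ : 0 ≤ β) (hρ : ∀ x x', 0 ≤ ρ x x')
    (Q : g.Site → X → X → Prop) {w : ℝ} (hw : 0 ≤ w)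
    (hdom : ∀ (y : g.Site) (f : FA), HolderOn ρ β (Q y) (grad f) (w * bout.loc y f))
    (P : X → X → Prop) {N : ℕ}
    (hchain : ∀ x x', P x x' → ∃ (n : ℕ) (z : ℕ → X), n ≤ N ∧ z 0 = x ∧ z n = x' ∧
      ∀ i < n, (∃ y, Q y (z i) (z (i + 1))) ∧ ρ (z i) (z (i + 1)) ≤ ρ x x') :
    HolderOn ρ β P (grad (𝓗 B)) (N * (w * (C * bB.κ * c * s))) := by
  obtain ⟨y₀⟩ := hne
  have hc0 : 0 ≤ c := hrow.nonneg y₀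
  have hs0 : 0 ≤ s := (bB.loc_nonneg y₀ B).trans (hs y₀)
  have hK0 : 0 ≤ C * bB.κ * c * s := mul_nonneg (mul_nonneg (mul_nonneg hC bB.κ_nonneg) hc0) hs0
  have hloc : ∀ y, HolderOn ρ β (Q y) (grad (𝓗 B)) (w * (C * bB.κ * c * s)) := fun y =>
    (hdom y (𝓗 B)).mono hρ (mul_le_mul_of_nonneg_left
      (loc_le_of_ineq190_segment bB bout y (hhom y) (hM y) 𝓗 h0 B dH hpath hC h190 hrow hs) hw)
  exact HolderOn.of_chains hβ hρ hchain (mul_nonneg hw hK0) hloc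

/-- The numerical shape of the constant: with κ_B = 1 (point blocks), s = 2·a (a = O(1)Mα₀ of (3.26): |V − 1| < a
⇒ |(1/i) log V| < 2a, as in (172) *"|V′ − 1| < C₁ε₁, hence V′ = exp iB′, |B′| < 2C₁ε₁"*) the bound reads
(2·N·w·C·c)·a — *"B₃O(1)Mα₀"* with B₃O(1) := 2NwCc. [cite: Balaban1987RG1, (3.26)-(3.27) p.275;
Balaban1985Variational, (172) p.305] -/
theorem line3_constant (N w C c a : ℝ) : N * (w * (C * 1 * c * (2 * a))) = (2 * N * w * C * c) * a := by ring

end Line3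

end Literature.MathematicalPhysics.QuantumFieldTheory.Balaban1983to89.B11HolderComplex
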